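import Summits.QuantumFields.BalabanUV.Beta.RowD1JointEndSym
import Summits.QuantumFields.BalabanUV.Beta.KernelWardHColumnSym

/-!
# `BalabanUV.Beta.RowD1JointEndSymLetters` — binder row D1, SYMMETRISED literal «JsB12Sym»: THE ROW's END AT JetData LEVEL FROM THE JET LETTERS ALONE
# (continuation of `RowD1JointEndSym`, which is at the 400-line cap: §6 = its §5 with the ℋ-column Ward socket `hH` DISCHARGED by `KernelWardHColumnSym`)

HONEST FRAMING (cell charter, verbatim): «discharging BetaPertH makes Balaban's UV stability UNCONDITIONAL — a real constructive-QFT result; it is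
NOT the continuum limit and NOT the Clay problem.»  HONEST DEPENDENCY: continuum YM on T⁴ ⇐ BetaPertH ∧ nine spine estimates (0/9 proved);
BetaPertH ⇐ (D1) ∧ (D4) ∧ CAP+tail; G-an2-4 gates asym, D1 and NE2/3/4.
DERIVED cell leaf (β sub-cell, BINDER-OWNERS row D1 OWNER `b2b-balaban-beta-an2`, gen 27; RULING R-D1-g27-2 — the root file `RowD1JointEndSym` (v1.3, 385 l.)
cannot take another ≈ 70-line END under the 400-line cap, so the planned APPEND-ONLY §6 is this one-theorem continuation module).  No statement of Bałaban's
papers, no `[cite:]`, no `Prop` fact, no `def`; EVERY hypothesis is a displayed binder.  WHAT: **`d1Drift_dressSymCtr_of_jetLetters_D1Tel_D1Rep`** =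
`RowD1JointEndSym.d1Drift_dressSymCtr_of_letters_bhKStep_symEc_D1Tel_D1Rep` (§5: spreads of record `bhKStep 3 Lc j` ∕ `symEc Lc`, `Spr`∕`RelInv` sockets
discharged) with the constants FIXED to `cH j := (stepScale 3 Lc j · Lc⁴)⁻¹` and the ℋ-column Ward law of `G_j := coDressKSymAt ctr Lc (KInvStep Lc j)`
SUPPLIED by `KernelWardHColumnSym.colH_ward_coDressKSymAt_KInvStep` (every `j`).  After it, the displayed hypotheses of the row's END are the JET LETTERS
ONLY — hW: (St)(Wt), (Sd) at the derived constant, (Wd), with their localised data (`Xʷ`, `X₂ʷ` commuting with `symEc Lc`, parity-odd `Nr`); hR∧hSX: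
(Sr-conj)(Wr-conj-c) with contacts `C`, `X₂`, compensators `Wc`, and `hcomp` — plus `D1Tel`, `D1Rep`, the printed B5 facts and the window: NO
literal-independent socket remains displayed.  HONEST: one displayed hypothesis became a theorem; the root-level classes {hW-letters, hR-letters, hcomp,
D1Tel, D1Rep} are 0∕5 discharged; `JsB12Sym⁰` is NOT yet a `def`; NOT D1, NOT `BetaPertH`, NOT continuum, NOT Clay.
Provenance: β sub-cell, unit beta-an2 gen 27, 2026-08-21 (v1); over `RowD1JointEndSym` v1.3 (p251630) and `KernelWardHColumnSym` BY NAME; no existing file touched.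
-/

open Finset
open scoped BigOperators
open Literature.MathematicalPhysics.QuantumFieldTheory
open Literature.MathematicalPhysics.QuantumFieldTheory.Balaban1983to89
open Literature.MathematicalPhysics.QuantumFieldTheory.Balaban1983to89.Beta
open Literature.MathematicalPhysics.QuantumFieldTheory.Balaban1983to89.Beta.VectorTailsLoc (fam kfam)
open Literature.MathematicalPhysics.QuantumFieldTheory.Balaban1983to89.Beta.VectorLegVolumeAdapter (MvE)
open ExpKernelCalculus (MKer Decays BiLoc comp tr tadpole shiftK)
open AffineAveraging (box toSite)
open AveragingContoursRooted (ctrOff ctrOff_mem_box)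
open PolarizationSign (reflSign WardTransversal AxisReflectionCovariant)
open KernelReflection (refK)
open ResolventReflection (bref Φ)
open OneStepResolventKernel (Fib LocStencil JetData)
open OneStepKernelFamily (KInvStep vertexOfK TbalOf flipK D1Tel D1Rep D1Drift)
open Summit.QuantumFields.BalabanUV.Beta.TameKernelCalculus
open Summit.QuantumFields.BalabanUV.Beta.ChartConjugation (conjV conjW)
open Summit.QuantumFields.BalabanUV.Beta.ChartConjugationDefectEnd (conjDefect)
open Summit.QuantumFields.BalabanUV.Beta.AxialDressingRooted (one_le_of_neZero)
open Summit.QuantumFields.BalabanUV.Beta.SymmetrisedDressingKernel (coDressKSymAt)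
open Summit.QuantumFields.BalabanUV.Beta.SymmetrisedDressingDress (dressSymAt)
open Summit.QuantumFields.BalabanUV.Beta.RowD1JointEndSym (d1Drift_dressSymCtr_of_letters_bhKStep_symEc_D1Tel_D1Rep)

namespace Summit.QuantumFields.BalabanUV.Beta.RowD1JointEndSymLetters

noncomputable section

variable {Lc : ℕ} [NeZero Lc]

/-! ## §6 The ℋ-column Ward socket discharged: `cH j := (stepScale 3 Lc j · Lc⁴)⁻¹`, `hH` := `KernelWardHColumnSym.colH_ward_coDressKSymAt_KInvStep` -/

open B6BondElimination (unitVec) in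
open KernelWard (divV divW) in
open Summit.QuantumFields.BalabanUV.Beta.BorderedHessian (sgnK bhKStep stepScale) in
open Summit.QuantumFields.BalabanUV.Beta.SymSliceProjectorKernel (symEc) in
open Summit.QuantumFields.BalabanUV.Beta.KernelWardHColumnSym (colH_ward_coDressKSymAt_KInvStep) in
/-- **ROW D1, SYMMETRISED LITERAL, JetData-LEVEL END FROM THE JET LETTERS ALONE** `RowD1JointEndSym` §5 `d1Drift_dressSymCtr_of_letters_bhKStep_symEc_D1Tel_D1Rep`
with the ℋ-column Ward law `hH` of `G_j := coDressKSymAt ctr Lc (KInvStep Lc j)` DISCHARGED by `KernelWardHColumnSym.colH_ward_coDressKSymAt_KInvStep` at the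
derived constants `cH j = (stepScale 3 Lc j · Lc⁴)⁻¹`.  Displayed hypotheses: the hW letters (St)(Wt)(Sd)(Wd) of the undressed jets `Js⁰` against
`bhKStep 3 Lc j` ∕ `symEc Lc` with their localised data, the compensated hR letters (Sr-conj)(Wr-conj-c) with contacts and compensators, `hcomp`; then
`D1Tel`, `D1Rep`, the printed B5 facts `h12`∕`h126` and the window.  HONEST: bookkeeping; 0∕5 root-level classes discharged. -/
theorem d1Drift_dressSymCtr_of_jetLetters_D1Tel_D1Rep (hLc : Odd Lc) (hL2 : 2 ≤ Lc) (Js : ℕ → JetData 3 Lc)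
    -- hW: the Ward letters of the undressed jets against `bhKStep 3 Lc j` ∕ `symEc Lc`
    (hSt : ∀ (j : ℕ) (κ' : Fin 4) (u t : Fin 4 → ℤ), (Js j).S κ' (u + (Lc : ℤ) • t) = ExpKernelCalculus.shiftK (-((Lc : ℤ) • t)) ((Js j).S κ' u))
    (hWt : ∀ (j : ℕ) (μ : Fin 4) (y : Fin 4 → ℤ) (ν : Fin 4) (y' t : Fin 4 → ℤ),
      (Js j).W μ (y + t) ν (y' + t) = ExpKernelCalculus.shiftK (-((Lc : ℤ) • t)) ((Js j).W μ y ν y'))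
    (Xw : ℕ → (Fin 4 → ℤ) → MKer 4 (Fib 3)) (hXw : ∀ j y, Loc (Xw j y)) (hEXw : ∀ j y, comp (symEc Lc) (Xw j y) = comp (Xw j y) (symEc Lc))
    (X₂w Nr : ℕ → (Fin 4 → ℤ) → Fin 4 → (Fin 4 → ℤ) → MKer 4 (Fib 3)) (hX₂w : ∀ j y ν y', Loc (X₂w j y ν y'))
    (hNr : ∀ j y ν y', Loc (Nr j y ν y')) (hEX₂w : ∀ j y ν y', comp (symEc Lc) (X₂w j y ν y') = comp (X₂w j y ν y') (symEc Lc))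
    (hSd : ∀ (j : ℕ) (y : Fin 4 → ℤ),
      (stepScale 3 Lc j * (Lc : ℝ) ^ (3 + 1))⁻¹ • ∑ v ∈ box 4 Lc, divV (Js j).S ((Lc : ℤ) • y + toSite v) = conjV (bhKStep 3 Lc j) (Xw j y))
    (hWd : ∀ (j : ℕ) (y : Fin 4 → ℤ) (ν : Fin 4) (y' : Fin 4 → ℤ),
      divW (Js j).W y ν y' = conjW (bhKStep 3 Lc j) 0 (vertexOfK (coDressKSymAt (toSite (ctrOff 4 Lc)) Lc (KInvStep (d := 3) Lc j)) Lc (Js j).S ν y')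
        (Xw j y) 0 (X₂w j y ν y') + Nr j y ν y')
    (hNt : ∀ j y ν y', trK (Nr j y ν y') = -sgnK (Nr j y ν y'))
    -- hR ∧ hSX: the compensated letters against `bhKStep 3 Lc j`
    (C : ℕ → Fin 4 → Fin 4 → (Fin 4 → ℤ) → MKer 4 (Fib 3)) (Cc δc : ℕ → ℝ) (hC : ∀ j α, LocStencil (C j α) (Cc j) (δc j))
    (hδc : ∀ j, 0 < δc j) (X₂ Wc : ℕ → Fin 4 → Fin 4 → (Fin 4 → ℤ) → Fin 4 → (Fin 4 → ℤ) → MKer 4 (Fib 3))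
    (hX₂ : ∀ j α μ y ν y', Loc (X₂ j α μ y ν y')) (hWc : ∀ j α μ y ν y', Loc (Wc j α μ y ν y'))
    (hSrC : ∀ (j : ℕ) (α κ' : Fin 4) (u : Fin 4 → ℤ),
      (Js j).S κ' (bref α κ' u) = reflSign α κ' • refK (Φ Lc α) ((Js j).S κ' u + conjV (bhKStep 3 Lc j) (C j α κ' u)))
    (hWrC : ∀ (j : ℕ) (α μ : Fin 4) (y : Fin 4 → ℤ) (ν : Fin 4) (y' : Fin 4 → ℤ),
      (Js j).W μ (bref α μ y) ν (bref α ν y') = (reflSign α μ * reflSign α ν) • refK (Φ Lc α) ((Js j).W μ y ν y' +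
        conjW (bhKStep 3 Lc j) (vertexOfK (coDressKSymAt (toSite (ctrOff 4 Lc)) Lc (KInvStep (d := 3) Lc j)) Lc (Js j).S μ y)
          (vertexOfK (coDressKSymAt (toSite (ctrOff 4 Lc)) Lc (KInvStep (d := 3) Lc j)) Lc (Js j).S ν y')
          (vertexOfK (coDressKSymAt (toSite (ctrOff 4 Lc)) Lc (KInvStep (d := 3) Lc j)) Lc (C j α) μ y)
          (vertexOfK (coDressKSymAt (toSite (ctrOff 4 Lc)) Lc (KInvStep (d := 3) Lc j)) Lc (C j α) ν y') (X₂ j α μ y ν y')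
          + Wc j α μ y ν y'))
    (hcomp : ∀ (j : ℕ) (α μ : Fin 4) (y : Fin 4 → ℤ) (ν : Fin 4) (y' : Fin 4 → ℤ),
      (1 / 2 : ℝ) * tadpole (coDressKSymAt (toSite (ctrOff 4 Lc)) Lc (KInvStep (d := 3) Lc j)) (Wc j α μ y ν y')
        + conjDefect (coDressKSymAt (toSite (ctrOff 4 Lc)) Lc (KInvStep (d := 3) Lc j)) (bhKStep 3 Lc j)
            (vertexOfK (coDressKSymAt (toSite (ctrOff 4 Lc)) Lc (KInvStep (d := 3) Lc j)) Lc (Js j).S μ y)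
            (vertexOfK (coDressKSymAt (toSite (ctrOff 4 Lc)) Lc (KInvStep (d := 3) Lc j)) Lc (Js j).S ν y')
            (vertexOfK (coDressKSymAt (toSite (ctrOff 4 Lc)) Lc (KInvStep (d := 3) Lc j)) Lc (C j α) μ y)
            (vertexOfK (coDressKSymAt (toSite (ctrOff 4 Lc)) Lc (KInvStep (d := 3) Lc j)) Lc (C j α) ν y') (X₂ j α μ y ν y') = 0)
    -- the route theorem's own binders, verbatim
    (a : ℝ) (ha : 0 < a)
    (h12 : B5.Prop12Printed (fam (fun i : ℕ+ × ℕ => ((i.1 : ℕ+) : ℕ)) (fun i => i.1.pos) MvE a ha))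
    (h126 : B5.Kernel126_127Printed (kfam (fun i : ℕ+ × ℕ => ((i.1 : ℕ+) : ℕ)) MvE))
    {L : Type*} {SL : Finset L} (hSL : SL.Nonempty) (k : L → Fin 4) {μ ν : Fin 4} (hμν : μ ≠ ν) {Nc : ℝ} (hNc : Nc ≠ 0)
    (Jc : ∀ m : ℕ, JetData 3 (Lc ^ m))
    (htel : D1Tel Lc (fun j => dressSymAt (ctrOff_mem_box (d := 4) (one_le_of_neZero Lc)) (Js j)) Jc)
    {cc : ℝ} {Mw' : ℕ → ℕ} (hc : 1 ≤ cc) (hMwin : ∀ L : ℕ, 2 ≤ L → 1 ≤ Mw' L ∧ (L : ℝ) ≤ cc * Mw' L) (hML : ∀ L : ℕ, 2 ≤ L → Mw' L ≤ L)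
    (hrep : D1Rep Lc Jc Nc μ ν a SL k) :
    D1Drift Lc (fun j => dressSymAt (ctrOff_mem_box (d := 4) (one_le_of_neZero Lc)) (Js j)) Nc μ ν :=
  d1Drift_dressSymCtr_of_letters_bhKStep_symEc_D1Tel_D1Rep hLc hL2 Js hSt hWt
    (fun j => (stepScale 3 Lc j * (Lc : ℝ) ^ (3 + 1))⁻¹)
    (fun j y κ' u => colH_ward_coDressKSymAt_KInvStep (d := 3) (Lc := Lc) j y κ' u)
    Xw hXw hEXw X₂w Nr hX₂w hNr hEX₂w hSd hWd hNt C Cc δc hC hδc X₂ Wc hX₂ hWc hSrC hWrC hcomp a ha h12 h126 hSL k hμν hNc Jc htel hc hMwin hML hrep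

end

end Summit.QuantumFields.BalabanUV.Beta.RowD1JointEndSymLetters
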